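import Literature.Analysis.ODE.HighOrderEnclosure
import Literature.Analysis.ODE.FlowWithin
import HarnessLib

/-!
# The C¹ high-order enclosure: validated bounds for the variational equation of an ODE step

Topic `Literature/Analysis/ODE`. The `C¹` extension of the order-`K` a priori enclosure test of
`HighOrderEnclosure.lean` (Nedialkov–Jackson–Pryce 2001), as used by `C¹`-Lohner-type
algorithms (Zgliczyński 2002; Walawska–Wilczak 2016, §2.1; Wilczak–Zgliczyński, `Cʳ`-Lohner
algorithm, §5) to enclose the solutions `V(t, x) = ∂φ(t, x)/∂x` of the VARIATIONAL EQUATION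

  `y' = f(y)`, `V' = Df(y) V`, `y(0) = x`, `V(0) = Id`

over one time step. Let `Φ j = f^[j]` be the Taylor coefficient functions of the autonomous
field `f : ℝⁿ → ℝⁿ` (`Φ 0 = id`, and on an open `Ω`: `Φ j` has derivative `Φ' j`, `Φ' j` has
derivative `Φ'' j`, with the recursion `Φ' j x (f x) = (j+1) • Φ (j+1) x`), so that the
augmented system `(y, V)' = (f y, Df(y) ∘ V)` has the Taylor coefficient maps
`(y, V) ↦ (Φ j y, Φ' j y ∘ V)` — the derivative of the recursion gives
`Φ' j y ∘ Df(y) + Φ'' j y (f y) = (j+1) • Φ' (j+1) y` (symmetry of second derivatives). Let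
`S ⊆ Ω` be the state enclosure with `Φ K (S) ⊆ [c, d]`, `𝒱 = [CV, DV]` an interval matrix
(read as the set of linear maps whose matrix entries `M eⱼ · eᵢ` lie in `[CV i j, DV i j]`),
and `[CN, DN] ⊇ {Φ' K z ∘ M : z ∈ S, M ∈ 𝒱}` (the interval product `Df^[K](S) 𝒱`). THE TEST:
for all `t ∈ [0, h]`,

  `∑_{j<K} t^j • Φ j x + t^K • [c, d] ⊆ S` and `∑_{j<K} t^j • Φ' j x + t^K • [CN, DN] ⊆ 𝒱`

(Walawska–Wilczak 2016, §2.1: `[0,h]^{m+1} ψ^[m+1](0,[ỹ],Id)·[Ṽ] ⊂ [E]` with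
`[Ṽ] = ∑_{i≤m} [0,h]^i ψ^[i](0,[x_k],Id) + [E]`). THEN (`exists_solution_of_variationalEnclosure`)
the augmented system has a solution `(y, V)` on `[0, h]` with `y 0 = x`, `V 0 = Id`,
`y t ∈ S`, `V t ∈ 𝒱`, and the TIGHT enclosures `y t ∈ ∑_{j<K} t^j Φ j x + t^K [c, d]`,
`V t ∈ ∑_{j<K} t^j Φ' j x + t^K [CN, DN]` (Walawska–Wilczak 2016, §2.2 Lemma 2 at `t = h`:
the predictor `[V⁰] = [A] + [R⁰] ⊇ ψ(h,[x_k],Id)`); for `f` Lipschitz on bounded sets EVERY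
solution pair is so enclosed (`solution_mem_of_variationalEnclosure`, `variationalEnclosure_step`
for a box `W` of initial points); and (`hasFDerivWithinAt_flow_of_variationalEnclosure`) for any
family `u` of solutions from `W` staying in `S`, the time-`τ` flow map `x ↦ u x τ` is
differentiable within `W` with derivative IN THAT ENCLOSURE (the variational equation gives the
derivative of the flow, `FlowWithin.lean`). This is the soundness statement behind the `C¹` part
of one step of a `C¹`-Lohner / CAPD `C1`-solver: the interval matrix
`J = ∑_{j<K} h^j Df^[j](W) + h^K Df^[K](S) Ṽ` contains `∂φ(h, x)/∂x` for every `x ∈ W`.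

Proof: the augmented system is an autonomous ODE on `ℝⁿ × L(ℝⁿ) ≅ ℝ^(n+n²)` (coordinates =
vector entries and matrix entries), to which `exists_solution_of_highOrderEnclosure` applies
verbatim; the boxes are transported along the coordinate isomorphism. Uniqueness of the `V`
component is Grönwall for linear equations (`norm_sub_le_of_linear`).

## References

* I. Walawska, D. Wilczak, *An implicit algorithm for validated enclosures of the solutions to
  variational equations for ODEs*, Appl. Math. Comput. 291 (2016) 303–322 (arXiv:1509.07388),
  §1.1 (`ψ(t,x,V) = D_xφ(t,x)·V`), §2.1 (the `C¹` high-order enclosure), §2.2 Algorithm 1 and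
  Lemma 2 (predictor `[V⁰] = [A] + [R⁰]`). [WalawskaWilczak2016]
* P. Zgliczyński, *C¹ Lohner algorithm*, Found. Comput. Math. 2 (2002) 429–465.
  [Zgliczynski2002C1Lohner]
* D. Wilczak, P. Zgliczyński, *Cʳ-Lohner algorithm*, Schedae Informaticae 20 (2011) 9–46,
  arXiv:0704.0720, §3 Lemma 6, §5. [WilczakZgliczynski2007]
* N. S. Nedialkov, K. R. Jackson, J. D. Pryce, Reliable Computing 7 (2001) 449–465, §3.
  [NedialkovJacksonPryce2001]
-/

noncomputable section

open Set Metric Filter Topology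

open scoped NNReal Nat

namespace Literature.Analysis.ODE

section Coord

variable (ι : Type*) [Fintype ι] [DecidableEq ι]

/-- Coordinates on `ℝⁿ × L(ℝⁿ)`: a continuous linear isomorphism onto `ℝ^(n + n²)` reading off
the entries of the vector and the matrix entries `V eⱼ · eᵢ` of the linear map (it lets the
high-order enclosure theorem of `HighOrderEnclosure.lean`, stated on `κ → ℝ`, act on the
variational system). [folklore] -/
private theorem exists_coordEquiv :
    ∃ Θ : ((ι → ℝ) × ((ι → ℝ) →L[ℝ] (ι → ℝ))) ≃L[ℝ] (ι ⊕ ι × ι → ℝ),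
      (∀ p i, Θ p (Sum.inl i) = p.1 i) ∧ ∀ p i j, Θ p (Sum.inr (i, j)) = p.2 (Pi.single j 1) i := by
  let e : ((ι → ℝ) × ((ι → ℝ) →L[ℝ] (ι → ℝ))) ≃ₗ[ℝ] (ι ⊕ ι × ι → ℝ) :=
  { toFun := fun p => Sum.elim p.1 (fun q : ι × ι => p.2 (Pi.single q.2 1) q.1)
    invFun := fun z => (fun i => z (Sum.inl i),
      LinearMap.toContinuousLinearMap (Matrix.toLin' (fun i j => z (Sum.inr (i, j)))))
    map_add' := fun p q => by
      funext k
      rcases k with i | ⟨i, j⟩ <;> simp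
    map_smul' := fun a p => by
      funext k
      rcases k with i | ⟨i, j⟩ <;> simp
    left_inv := fun p => by
      refine Prod.ext rfl ?_
      have hM : (fun i j => p.2 (Pi.single j 1) i) =
          LinearMap.toMatrix' (p.2 : (ι → ℝ) →ₗ[ℝ] (ι → ℝ)) := by
        funext i j
        rw [LinearMap.toMatrix'_apply]
        rfl
      ext v i
      simp only [Sum.elim_inr]
      rw [hM, Matrix.toLin'_toMatrix']
      simp
    right_inv := fun z => by
      funext k
      rcases k with i | ⟨i, j⟩
      · simp
      · simp only [Sum.elim_inr, LinearMap.coe_toContinuousLinearMap']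
        rw [← LinearMap.toMatrix'_apply, LinearMap.toMatrix'_toLin'] }
  exact ⟨e.toContinuousLinearEquiv, fun p i => rfl, fun p i j => rfl⟩

end Coord

section Unique

variable {E : Type*} [NormedAddCommGroup E] [NormedSpace ℝ E]

/-- Uniqueness on `[0, h]` of solutions of `y' = f(y)` for `f` Lipschitz on bounded sets
(Picard–Lindelöf uniqueness, Mathlib's `ODE_solution_unique_of_mem_Icc_right` on a ball
containing both compact trajectories). [folklore] -/
private theorem eqOn_Icc_of_locLipschitz {f : E → E}
    (hloc : ∀ ρ : ℝ, ∃ K' : ℝ≥0, LipschitzOnWith K' f (closedBall 0 ρ)) {y z : ℝ → E} {h : ℝ}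
    (hy : ∀ t ∈ Icc 0 h, HasDerivWithinAt y (f (y t)) (Icc 0 h) t)
    (hz : ∀ t ∈ Icc 0 h, HasDerivWithinAt z (f (z t)) (Icc 0 h) t) (h0 : y 0 = z 0) :
    EqOn y z (Icc 0 h) := by
  have hyc : ContinuousOn y (Icc 0 h) := fun s hs => (hy s hs).continuousWithinAt
  have hzc : ContinuousOn z (Icc 0 h) := fun s hs => (hz s hs).continuousWithinAt
  obtain ⟨Cy, hCy⟩ := isCompact_Icc.exists_bound_of_continuousOn hyc
  obtain ⟨Cz, hCz⟩ := isCompact_Icc.exists_bound_of_continuousOn hzc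
  obtain ⟨K', hK'⟩ := hloc (max Cy Cz)
  have hnhds : ∀ s ∈ Ico (0 : ℝ) h, Icc 0 h ∈ 𝓝[≥] s := fun s hs =>
    mem_of_superset (Icc_mem_nhdsGE hs.2) (Icc_subset_Icc_left hs.1)
  exact ODE_solution_unique_of_mem_Icc_right (v := fun _ => f)
    (s := fun _ => closedBall 0 (max Cy Cz)) (K := K') (fun _ _ => hK') hyc
    (fun s hs => (hy s (Ico_subset_Icc_self hs)).mono_of_mem_nhdsWithin (hnhds s hs))
    (fun s hs =>
      mem_closedBall_zero_iff.2 ((hCy s (Ico_subset_Icc_self hs)).trans (le_max_left _ _)))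
    hzc
    (fun s hs => (hz s (Ico_subset_Icc_self hs)).mono_of_mem_nhdsWithin (hnhds s hs))
    (fun s hs =>
      mem_closedBall_zero_iff.2 ((hCz s (Ico_subset_Icc_self hs)).trans (le_max_right _ _)))
    h0

/-- Uniqueness of solutions of the linear equation `J' = A(t) ∘ J` on `[0, h]` with bounded
coefficients (Grönwall, via `norm_sub_le_of_linear` of `FlowWithin.lean`). [folklore] -/
private theorem eqOn_Icc_of_linear {A : ℝ → E →L[ℝ] E} {h M : ℝ} {J₁ J₂ : ℝ → E →L[ℝ] E}
    (hJ₁ : ∀ t ∈ Icc 0 h, HasDerivWithinAt J₁ ((A t).comp (J₁ t)) (Icc 0 h) t)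
    (hJ₂ : ∀ t ∈ Icc 0 h, HasDerivWithinAt J₂ ((A t).comp (J₂ t)) (Icc 0 h) t)
    (hM : ∀ t ∈ Ico 0 h, ‖A t‖ ≤ M) (h0 : J₁ 0 = J₂ 0) : EqOn J₁ J₂ (Icc 0 h) := by
  intro t ht
  have hc : ContinuousOn J₂ (Icc 0 h) := fun s hs => (hJ₂ s hs).continuousWithinAt
  obtain ⟨P, hP⟩ := isCompact_Icc.exists_bound_of_continuousOn hc
  have key := norm_sub_le_of_linear hJ₁ hJ₂ hM (fun s _ => by simp) (fun s hs =>
    hP s (Ico_subset_Icc_self hs)) le_rfl t ht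
  rw [h0, sub_self, norm_zero, zero_mul, gronwallBound_ε0_δ0] at key
  exact sub_eq_zero.1 (norm_le_zero_iff.1 key)

end Unique

section Variational

variable {ι : Type*} [Fintype ι] [DecidableEq ι]

/-- **The `C¹` high-order enclosure test: an enclosed solution of the variational system exists
on the whole step (Walawska–Wilczak 2016, §2.1 and §2.2 Lemma 2; Zgliczyński 2002).**
With the Taylor coefficient data `Φ, Φ', Φ''` of `f` as in the module docstring (`Φ 0 = id`,
`Φ' 0 = Id`; on the open `Ω ⊇ S`: `Φ j` (`j ≤ K`) has derivative `Φ' j`, `Φ' j` (`j < K`) has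
derivative `Φ'' j`, `f` has derivative `f'`, recursion `Φ' j x (f x) = (j+1) • Φ (j+1) x`;
norm bounds `‖Φ' j‖, ‖Φ'' j‖ ≤ B` on `S`; `Φ K`, `Φ' K` Lipschitz on `S`; `Φ K (S) ⊆ [c, d]` and
`Φ' K z ∘ M ∈ [CN, DN]` entrywise for `z ∈ S`, `M ∈ [CV, DV]`), `0 < K`, `0 ≤ h`: if for all
`t ∈ [0, h]` the state test `∑_{j<K} t^j • Φ j x + t^K • v ∈ S` (`v ∈ [c, d]`) and the `C¹` test
`∑_{j<K} t^j • Φ' j x + t^K • N ∈ [CV, DV]` (`N ∈ [CN, DN]`, entrywise) hold, then the system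
`y' = f(y)`, `V' = f'(y) ∘ V`, `y 0 = x`, `V 0 = Id` has a solution on `[0, h]` with `y t ∈ S`,
`y t = ∑_{j<K} t^j • Φ j x + t^K • v_t` (`v_t ∈ [c, d]`), `V t ∈ [CV, DV]` and
`V t = ∑_{j<K} t^j • Φ' j x + t^K • N_t` (`N_t ∈ [CN, DN]`) for every `t ∈ [0, h]`.
[cite: WalawskaWilczak2016, §2.1 (C¹ high-order enclosure) and §2.2 Lemma 2] -/
theorem exists_solution_of_variationalEnclosure {f : (ι → ℝ) → ι → ℝ}
    {f' : (ι → ℝ) → ((ι → ℝ) →L[ℝ] (ι → ℝ))}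
    {Φ : ℕ → (ι → ℝ) → ι → ℝ} {Φ' : ℕ → (ι → ℝ) → ((ι → ℝ) →L[ℝ] (ι → ℝ))}
    {Φ'' : ℕ → (ι → ℝ) → ((ι → ℝ) →L[ℝ] (ι → ℝ) →L[ℝ] (ι → ℝ))} {Ω S : Set (ι → ℝ)}
    {K : ℕ} (hK : 0 < K) {L L' : ℝ≥0} {B : ℝ} {c d x : ι → ℝ} {CV DV CN DN : ι → ι → ℝ} {h : ℝ}
    (hΩ : IsOpen Ω) (hSΩ : S ⊆ Ω)
    (hΦ0 : ∀ x, Φ 0 x = x) (hΦ'0 : ∀ x, Φ' 0 x = 1)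
    (hder : ∀ j ≤ K, ∀ x ∈ Ω, HasFDerivAt (Φ j) (Φ' j x) x)
    (hder2 : ∀ j < K, ∀ x ∈ Ω, HasFDerivAt (Φ' j) (Φ'' j x) x)
    (hf' : ∀ x ∈ Ω, HasFDerivAt f (f' x) x)
    (hrec : ∀ j < K, ∀ x ∈ Ω, Φ' j x (f x) = ((j : ℝ) + 1) • Φ (j + 1) x)
    (hbd : ∀ j ≤ K, ∀ x ∈ S, ‖Φ' j x‖ ≤ B) (hbd2 : ∀ j < K, ∀ x ∈ S, ‖Φ'' j x‖ ≤ B)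
    (hlipK : LipschitzOnWith L (Φ K) S) (hlipK' : LipschitzOnWith L' (Φ' K) S)
    (hcd : c ≤ d) (hKS : MapsTo (Φ K) S (Icc c d)) (hCDN : CN ≤ DN)
    (hKN : ∀ z ∈ S, ∀ M : (ι → ℝ) →L[ℝ] (ι → ℝ), (fun i j => M (Pi.single j 1) i) ∈ Icc CV DV →
      (fun i j => (Φ' K z).comp M (Pi.single j 1) i) ∈ Icc CN DN)
    (hh : 0 ≤ h)
    (hincl : ∀ t ∈ Icc 0 h, ∀ v ∈ Icc c d,
      (∑ j ∈ Finset.range K, t ^ j • Φ j x) + t ^ K • v ∈ S)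
    (hinclV : ∀ t ∈ Icc 0 h, ∀ N : (ι → ℝ) →L[ℝ] (ι → ℝ),
      (fun i j => N (Pi.single j 1) i) ∈ Icc CN DN →
      (fun i j => ((∑ k ∈ Finset.range K, t ^ k • Φ' k x) + t ^ K • N) (Pi.single j 1) i) ∈
        Icc CV DV) :
    ∃ y : ℝ → ι → ℝ, ∃ V : ℝ → (ι → ℝ) →L[ℝ] (ι → ℝ), y 0 = x ∧ V 0 = 1 ∧
      (∀ t ∈ Icc 0 h, HasDerivWithinAt y (f (y t)) (Icc 0 h) t) ∧
      (∀ t ∈ Icc 0 h, HasDerivWithinAt V ((f' (y t)).comp (V t)) (Icc 0 h) t) ∧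
      ∀ t ∈ Icc 0 h, (y t ∈ S ∧ ∃ v ∈ Icc c d,
          y t = (∑ j ∈ Finset.range K, t ^ j • Φ j x) + t ^ K • v) ∧
        (fun i j => V t (Pi.single j 1) i) ∈ Icc CV DV ∧
        ∃ N : (ι → ℝ) →L[ℝ] (ι → ℝ), (fun i j => N (Pi.single j 1) i) ∈ Icc CN DN ∧
          V t = (∑ j ∈ Finset.range K, t ^ j • Φ' j x) + t ^ K • N := by
  classical
  obtain ⟨Θ, hΘ1, hΘ2⟩ := exists_coordEquiv ι
  have hΘs1 : ∀ z i, (Θ.symm z).1 i = z (Sum.inl i) := fun z i => by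
    rw [← hΘ1 (Θ.symm z) i, ContinuousLinearEquiv.apply_symm_apply]
  have hΘs2 : ∀ z i j, (Θ.symm z).2 (Pi.single j 1) i = z (Sum.inr (i, j)) := fun z i j => by
    rw [← hΘ2 (Θ.symm z) i j, ContinuousLinearEquiv.apply_symm_apply]
  -- the entrywise boxes of linear maps
  set 𝒱 : Set ((ι → ℝ) →L[ℝ] (ι → ℝ)) := {M | (fun i j => M (Pi.single j 1) i) ∈ Icc CV DV}
    with h𝒱
  set 𝒩 : Set ((ι → ℝ) →L[ℝ] (ι → ℝ)) := {N | (fun i j => N (Pi.single j 1) i) ∈ Icc CN DN}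
    with h𝒩
  -- a norm bound on `𝒱`
  set Θi : (ι ⊕ ι × ι → ℝ) →L[ℝ] (ι → ℝ) × ((ι → ℝ) →L[ℝ] (ι → ℝ)) :=
    ((Θ.symm : (ι ⊕ ι × ι → ℝ) ≃L[ℝ] (ι → ℝ) × ((ι → ℝ) →L[ℝ] (ι → ℝ))) :
      (ι ⊕ ι × ι → ℝ) →L[ℝ] (ι → ℝ) × ((ι → ℝ) →L[ℝ] (ι → ℝ))) with hΘi_def
  have hΘi : ∀ w, Θi w = Θ.symm w := fun w => rfl
  obtain ⟨R, hR⟩ : ∃ R : ℝ, ∀ M ∈ 𝒱, ‖M‖ ≤ R := by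
    refine ⟨‖Θi‖ * ‖fun q : ι × ι => |CV q.1 q.2| + |DV q.1 q.2|‖, fun M hM => ?_⟩
    have h1 : ‖Θ ((0 : ι → ℝ), M)‖ ≤ ‖fun q : ι × ι => |CV q.1 q.2| + |DV q.1 q.2|‖ := by
      refine (pi_norm_le_iff_of_nonneg (norm_nonneg _)).2 fun k => ?_
      rcases k with i | ⟨i, j⟩
      · rw [hΘ1]
        simp
      · rw [hΘ2, Real.norm_eq_abs]
        have lo : CV i j ≤ M (Pi.single j 1) i := hM.1 i j
        have hi : M (Pi.single j 1) i ≤ DV i j := hM.2 i j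
        calc |M (Pi.single j 1) i| ≤ |CV i j| + |DV i j| :=
              (abs_le_max_abs_abs lo hi).trans (max_le_add_of_nonneg (abs_nonneg _) (abs_nonneg _))
          _ ≤ ‖fun q : ι × ι => |CV q.1 q.2| + |DV q.1 q.2|‖ := by
              have := norm_le_pi_norm (fun q : ι × ι => |CV q.1 q.2| + |DV q.1 q.2|) (i, j)
              rwa [Real.norm_of_nonneg (by positivity)] at this
    calc ‖M‖ ≤ ‖((0 : ι → ℝ), M)‖ := by simp [Prod.norm_def]
      _ = ‖Θi (Θ (0, M))‖ := by rw [hΘi, ContinuousLinearEquiv.symm_apply_apply]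
      _ ≤ ‖Θi‖ * ‖Θ (0, M)‖ := Θi.le_opNorm _
      _ ≤ _ := mul_le_mul_of_nonneg_left h1 (norm_nonneg Θi)
  -- `f = Φ 1`, `f' = Φ' 1` on `Ω`, and the differentiated Taylor-coefficient recursion
  have hfΦ : ∀ y ∈ Ω, f y = Φ 1 y := fun y hy => by
    have h1 := hrec 0 hK y hy
    simpa [hΦ'0] using h1
  have hf'Φ : ∀ y ∈ Ω, f' y = Φ' 1 y := fun y hy => by
    have h1 : HasFDerivAt f (Φ' 1 y) y :=
      (hder 1 (Nat.succ_le_of_lt hK) y hy).congr_of_eventuallyEq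
        ((hΩ.eventually_mem hy).mono fun z hz => hfΦ z hz)
    exact (hf' y hy).unique h1
  have key : ∀ j < K, ∀ y ∈ Ω,
      (Φ' j y).comp (f' y) + Φ'' j y (f y) = ((j : ℝ) + 1) • Φ' (j + 1) y := by
    intro j hj y hy
    have hnhds : ∀ᶠ z in 𝓝 y, z ∈ Ω := hΩ.eventually_mem hy
    have hsymm : ∀ v w, Φ'' j y v w = Φ'' j y w v :=
      second_derivative_symmetric_of_eventually (hnhds.mono fun z hz => hder j hj.le z hz)
        (hder2 j hj y hy)
    have h1 : HasFDerivAt (fun z => Φ' j z (f z)) ((Φ' j y).comp (f' y) + (Φ'' j y).flip (f y)) y :=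
      (hder2 j hj y hy).clm_apply (hf' y hy)
    have h2 : HasFDerivAt (fun z => ((j : ℝ) + 1) • Φ (j + 1) z) (((j : ℝ) + 1) • Φ' (j + 1) y) y :=
      (hder (j + 1) (Nat.succ_le_of_lt hj) y hy).const_smul ((j : ℝ) + 1)
    have h12 : (fun z => Φ' j z (f z)) =ᶠ[𝓝 y] fun z => ((j : ℝ) + 1) • Φ (j + 1) z :=
      hnhds.mono fun z hz => hrec j hj z hz
    have h3 := h1.unique (h2.congr_of_eventuallyEq h12)
    have hflip : (Φ'' j y).flip (f y) = Φ'' j y (f y) := by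
      ext v
      rw [ContinuousLinearMap.flip_apply, hsymm]
    rwa [hflip] at h3
  -- the augmented ("variational") system on `F := ℝⁿ × L(ℝⁿ)` and its Taylor coefficient maps
  let F := (ι → ℝ) × ((ι → ℝ) →L[ℝ] (ι → ℝ))
  obtain ⟨Ψ, hΨ⟩ : ∃ Ψ : ℕ → F → F, ∀ j p, Ψ j p = (Φ j p.1, (Φ' j p.1).comp p.2) :=
    ⟨_, fun _ _ => rfl⟩
  obtain ⟨Ψ', hΨ'⟩ : ∃ Ψ' : ℕ → F → (F →L[ℝ] F), ∀ j p, Ψ' j p =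
      ((Φ' j p.1).comp (ContinuousLinearMap.fst ℝ (ι → ℝ) ((ι → ℝ) →L[ℝ] (ι → ℝ)))).prod
        ((ContinuousLinearMap.compL ℝ (ι → ℝ) (ι → ℝ) (ι → ℝ) (Φ' j p.1)).comp
            (ContinuousLinearMap.snd ℝ (ι → ℝ) ((ι → ℝ) →L[ℝ] (ι → ℝ))) +
          ((ContinuousLinearMap.compL ℝ (ι → ℝ) (ι → ℝ) (ι → ℝ)).flip p.2).comp
            ((Φ'' j p.1).comp (ContinuousLinearMap.fst ℝ (ι → ℝ) ((ι → ℝ) →L[ℝ] (ι → ℝ))))) :=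
    ⟨_, fun _ _ => rfl⟩
  obtain ⟨Fa, hFa⟩ : ∃ Fa : F → F, ∀ p, Fa p = (f p.1, (f' p.1).comp p.2) := ⟨_, fun _ => rfl⟩
  -- transported to `ℝ^(n + n²)` along `Θ`
  set Θl : F →L[ℝ] (ι ⊕ ι × ι → ℝ) :=
    ((Θ : F ≃L[ℝ] (ι ⊕ ι × ι → ℝ)) : F →L[ℝ] (ι ⊕ ι × ι → ℝ)) with hΘl_def
  have hΘl : ∀ p, Θl p = Θ p := fun p => rfl
  obtain ⟨Φa, hΦa⟩ : ∃ Φa : ℕ → (ι ⊕ ι × ι → ℝ) → (ι ⊕ ι × ι → ℝ),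
      ∀ j w, Φa j w = Θ (Ψ j (Θ.symm w)) := ⟨_, fun _ _ => rfl⟩
  obtain ⟨Φa', hΦa'⟩ : ∃ Φa' : ℕ → (ι ⊕ ι × ι → ℝ) → ((ι ⊕ ι × ι → ℝ) →L[ℝ] (ι ⊕ ι × ι → ℝ)),
      ∀ j w, Φa' j w = Θl.comp ((Ψ' j (Θ.symm w)).comp Θi) := ⟨_, fun _ _ => rfl⟩
  obtain ⟨fa, hfa⟩ : ∃ fa : (ι ⊕ ι × ι → ℝ) → (ι ⊕ ι × ι → ℝ), ∀ w, fa w = Θ (Fa (Θ.symm w)) :=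
    ⟨_, fun _ => rfl⟩
  set S' : Set (ι ⊕ ι × ι → ℝ) := {w | (Θ.symm w).1 ∈ S ∧ (Θ.symm w).2 ∈ 𝒱} with hS'
  set Ω' : Set (ι ⊕ ι × ι → ℝ) := {w | (Θ.symm w).1 ∈ Ω} with hΩ'
  set c' : ι ⊕ ι × ι → ℝ := Sum.elim c fun q => CN q.1 q.2 with hc'
  set d' : ι ⊕ ι × ι → ℝ := Sum.elim d fun q => DN q.1 q.2 with hd'
  set w₀ : ι ⊕ ι × ι → ℝ := Θ (x, 1) with hw₀
  -- the hypotheses of the high-order enclosure test for the augmented system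
  have hS'Ω' : S' ⊆ Ω' := fun w hw => hSΩ hw.1
  have hΦa0 : ∀ w, Φa 0 w = w := fun w => by
    rw [hΦa, hΨ, hΦ0, hΦ'0, ContinuousLinearMap.one_def, ContinuousLinearMap.id_comp]
    simp only [Prod.mk.eta, ContinuousLinearEquiv.apply_symm_apply]
  have hdera : ∀ j < K, ∀ w ∈ Ω', HasFDerivAt (Φa j) (Φa' j w) w := by
    intro j hj w hw
    have hy : (Θ.symm w).1 ∈ Ω := hw
    have hA : HasFDerivAt (fun p : F => Φ j p.1)
        ((Φ' j (Θ.symm w).1).comp (ContinuousLinearMap.fst ℝ (ι → ℝ) ((ι → ℝ) →L[ℝ] (ι → ℝ))))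
        (Θ.symm w) :=
      (hder j hj.le _ hy).comp _ hasFDerivAt_fst
    have hB : HasFDerivAt (fun p : F => (Φ' j p.1).comp p.2)
        ((ContinuousLinearMap.compL ℝ (ι → ℝ) (ι → ℝ) (ι → ℝ) (Φ' j (Θ.symm w).1)).comp
            (ContinuousLinearMap.snd ℝ (ι → ℝ) ((ι → ℝ) →L[ℝ] (ι → ℝ))) +
          ((ContinuousLinearMap.compL ℝ (ι → ℝ) (ι → ℝ) (ι → ℝ)).flip (Θ.symm w).2).comp
            ((Φ'' j (Θ.symm w).1).comp
              (ContinuousLinearMap.fst ℝ (ι → ℝ) ((ι → ℝ) →L[ℝ] (ι → ℝ)))))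
        (Θ.symm w) :=
      ((hder2 j hj _ hy).comp _ hasFDerivAt_fst).clm_comp hasFDerivAt_snd
    have hp : HasFDerivAt (Ψ j) (Ψ' j (Θ.symm w)) (Θ.symm w) := by
      have hfun : Ψ j = fun p : F => (Φ j p.1, (Φ' j p.1).comp p.2) := funext fun p => hΨ j p
      rw [hfun, hΨ']
      exact hA.prodMk hB
    have hfun : Φa j = ⇑Θ ∘ (Ψ j ∘ ⇑Θ.symm) := funext fun w => by rw [hΦa]; rfl
    rw [hfun, hΦa']
    exact Θ.hasFDerivAt.comp w (hp.comp w Θ.symm.hasFDerivAt)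
  have hreca : ∀ j < K, ∀ w ∈ Ω', Φa' j w (fa w) = ((j : ℝ) + 1) • Φa (j + 1) w := by
    intro j hj w hw
    have hy : (Θ.symm w).1 ∈ Ω := hw
    rw [hΦa', hfa, hΦa, ContinuousLinearMap.comp_apply, ContinuousLinearMap.comp_apply, hΘi,
      ContinuousLinearEquiv.symm_apply_apply, hΘl, ← map_smul]
    congr 1
    rw [hΨ', hFa, hΨ]
    simp only [Prod.smul_mk]
    refine Prod.ext (hrec j hj _ hy) ?_
    show (Φ' j (Θ.symm w).1).comp ((f' (Θ.symm w).1).comp (Θ.symm w).2) +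
        (Φ'' j (Θ.symm w).1 (f (Θ.symm w).1)).comp (Θ.symm w).2 =
      ((j : ℝ) + 1) • (Φ' (j + 1) (Θ.symm w).1).comp (Θ.symm w).2
    rw [← ContinuousLinearMap.comp_assoc, ← ContinuousLinearMap.add_comp, key j hj _ hy,
      ContinuousLinearMap.smul_comp]
  have hR0 : ∀ M ∈ 𝒱, (0 : ℝ) ≤ R := fun M hM => (norm_nonneg _).trans (hR M hM)
  have hbda : ∀ j < K, ∀ w ∈ S', ‖Φa' j w‖ ≤ ‖Θl‖ * (max B (B + R * B) * ‖Θi‖) := by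
    intro j hj w hw
    obtain ⟨hy, hV⟩ := hw
    rw [hΦa']
    refine (Θl.opNorm_comp_le _).trans (mul_le_mul_of_nonneg_left ?_ (norm_nonneg _))
    refine ((Ψ' j (Θ.symm w)).opNorm_comp_le Θi).trans
      (mul_le_mul_of_nonneg_right ?_ (norm_nonneg _))
    rw [hΨ', ContinuousLinearMap.opNorm_prod, Prod.norm_def]
    refine max_le_max ?_ ((norm_add_le _ _).trans (add_le_add ?_ ?_))
    · refine (ContinuousLinearMap.opNorm_comp_le _ _).trans ?_
      refine (mul_le_mul_of_nonneg_left (ContinuousLinearMap.norm_fst_le ℝ (ι → ℝ)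
        ((ι → ℝ) →L[ℝ] (ι → ℝ))) (norm_nonneg _)).trans ?_
      rw [mul_one]
      exact hbd j hj.le _ hy
    · refine (ContinuousLinearMap.opNorm_comp_le _ _).trans ?_
      refine (mul_le_mul_of_nonneg_left (ContinuousLinearMap.norm_snd_le ℝ (ι → ℝ)
        ((ι → ℝ) →L[ℝ] (ι → ℝ))) (norm_nonneg _)).trans ?_
      rw [mul_one]
      refine ((ContinuousLinearMap.compL ℝ (ι → ℝ) (ι → ℝ) (ι → ℝ)).le_opNorm _).trans ?_
      refine (mul_le_mul_of_nonneg_right (ContinuousLinearMap.norm_compL_le ℝ (ι → ℝ) (ι → ℝ)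
        (ι → ℝ)) (norm_nonneg _)).trans ?_
      rw [one_mul]
      exact hbd j hj.le _ hy
    · refine (ContinuousLinearMap.opNorm_comp_le _ _).trans ?_
      have h1 : ‖(ContinuousLinearMap.compL ℝ (ι → ℝ) (ι → ℝ) (ι → ℝ)).flip (Θ.symm w).2‖ ≤ R := by
        refine (((ContinuousLinearMap.compL ℝ (ι → ℝ) (ι → ℝ) (ι → ℝ)).flip).le_opNorm _).trans ?_
        rw [ContinuousLinearMap.opNorm_flip]
        refine (mul_le_mul_of_nonneg_right (ContinuousLinearMap.norm_compL_le ℝ (ι → ℝ) (ι → ℝ)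
          (ι → ℝ)) (norm_nonneg _)).trans ?_
        rw [one_mul]
        exact hR _ hV
      have h2 : ‖(Φ'' j (Θ.symm w).1).comp
          (ContinuousLinearMap.fst ℝ (ι → ℝ) ((ι → ℝ) →L[ℝ] (ι → ℝ)))‖ ≤ B := by
        refine (ContinuousLinearMap.opNorm_comp_le _ _).trans ?_
        refine (mul_le_mul_of_nonneg_left (ContinuousLinearMap.norm_fst_le ℝ (ι → ℝ)
          ((ι → ℝ) →L[ℝ] (ι → ℝ))) (norm_nonneg _)).trans ?_
        rw [mul_one]
        exact hbd2 j hj _ hy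
      exact mul_le_mul h1 h2 (norm_nonneg _) (hR0 _ hV)
  -- Lipschitz continuity of the top coefficient map of the augmented system on `S'`
  have hΨK : LipschitzOnWith (max L (L' * R.toNNReal + B.toNNReal)) (Ψ K)
      {p : F | p.1 ∈ S ∧ p.2 ∈ 𝒱} := by
    have e1 : LipschitzOnWith L (fun p : F => Φ K p.1) {p : F | p.1 ∈ S ∧ p.2 ∈ 𝒱} := by
      have h1 : LipschitzOnWith 1 (Prod.fst : F → ι → ℝ) {p : F | p.1 ∈ S ∧ p.2 ∈ 𝒱} :=
        LipschitzWith.prod_fst.lipschitzOnWith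
      have := hlipK.comp h1 (fun p hp => hp.1)
      rw [mul_one] at this
      exact this
    have e2 : LipschitzOnWith (L' * R.toNNReal + B.toNNReal) (fun p : F => (Φ' K p.1).comp p.2)
        {p : F | p.1 ∈ S ∧ p.2 ∈ 𝒱} := by
      refine LipschitzOnWith.of_dist_le_mul fun p hp q hq => ?_
      rw [dist_eq_norm, dist_eq_norm]
      have hsplit : (Φ' K p.1).comp p.2 - (Φ' K q.1).comp q.2 =
          (Φ' K p.1 - Φ' K q.1).comp p.2 + (Φ' K q.1).comp (p.2 - q.2) := by
        rw [ContinuousLinearMap.sub_comp, ContinuousLinearMap.comp_sub]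
        abel
      rw [hsplit]
      have hL' : ‖Φ' K p.1 - Φ' K q.1‖ ≤ L' * ‖p - q‖ := by
        refine (hlipK'.norm_sub_le hp.1 hq.1).trans (mul_le_mul_of_nonneg_left ?_ L'.coe_nonneg)
        have := norm_fst_le (p - q)
        rwa [Prod.fst_sub] at this
      calc ‖(Φ' K p.1 - Φ' K q.1).comp p.2 + (Φ' K q.1).comp (p.2 - q.2)‖
          ≤ ‖Φ' K p.1 - Φ' K q.1‖ * ‖p.2‖ + ‖Φ' K q.1‖ * ‖p.2 - q.2‖ :=
            (norm_add_le _ _).trans (add_le_add (ContinuousLinearMap.opNorm_comp_le _ _)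
              (ContinuousLinearMap.opNorm_comp_le _ _))
        _ ≤ (L' * ‖p - q‖) * R.toNNReal + B.toNNReal * ‖p - q‖ := by
            refine add_le_add (mul_le_mul hL' ?_ (norm_nonneg _) (by positivity))
              (mul_le_mul ?_ ?_ (norm_nonneg _) (by positivity))
            · exact (hR _ hp.2).trans (Real.le_coe_toNNReal R)
            · exact (hbd K le_rfl _ hq.1).trans (Real.le_coe_toNNReal B)
            · have := norm_snd_le (p - q)
              rwa [Prod.snd_sub] at this
        _ = (L' * R.toNNReal + B.toNNReal : ℝ≥0) * ‖p - q‖ := by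
            push_cast
            ring
    have hfun : Ψ K = fun p : F => (Φ K p.1, (Φ' K p.1).comp p.2) := funext fun p => hΨ K p
    rw [hfun]
    exact e1.prodMk e2
  have hlipa :
      LipschitzOnWith (‖Θl‖₊ * (max L (L' * R.toNNReal + B.toNNReal) * ‖Θi‖₊)) (Φa K) S' := by
    have hmaps : MapsTo (⇑Θ.symm) S' {p : F | p.1 ∈ S ∧ p.2 ∈ 𝒱} := fun w hw => hw
    have h1 := hΨK.comp (Θ.symm.lipschitz.lipschitzOnWith) hmaps
    have h2 := Θ.lipschitz.comp_lipschitzOnWith h1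
    have hfun : Φa K = ⇑Θ ∘ (Ψ K ∘ ⇑Θ.symm) := funext fun w => by rw [hΦa]; rfl
    rw [hfun]
    exact h2
  have hcd' : c' ≤ d' := fun k => by
    rcases k with i | ⟨i, j⟩
    · exact hcd i
    · exact hCDN i j
  have hKSa : MapsTo (Φa K) S' (Icc c' d') := by
    intro w hw
    obtain ⟨hy, hV⟩ := hw
    have hN := hKN _ hy _ hV
    rw [hΦa, hΨ]
    constructor
    · intro k
      rcases k with i | ⟨i, j⟩
      · rw [hΘ1]
        exact (hKS hy).1 i
      · rw [hΘ2]
        exact hN.1 i j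
    · intro k
      rcases k with i | ⟨i, j⟩
      · rw [hΘ1]
        exact (hKS hy).2 i
      · rw [hΘ2]
        exact hN.2 i j
  -- the Taylor sums of the augmented system, read back in `F`
  have hdec : ∀ (t : ℝ) (v' : ι ⊕ ι × ι → ℝ),
      Θ.symm ((∑ j ∈ Finset.range K, t ^ j • Φa j w₀) + t ^ K • v') =
        ((∑ j ∈ Finset.range K, t ^ j • Φ j x) + t ^ K • (Θ.symm v').1,
          (∑ j ∈ Finset.range K, t ^ j • Φ' j x) + t ^ K • (Θ.symm v').2) := by
    intro t v'
    have hj : ∀ j, Θ.symm (Φa j w₀) = (Φ j x, Φ' j x) := fun j => by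
      rw [hΦa, hw₀, ContinuousLinearEquiv.symm_apply_apply, hΨ,
        ContinuousLinearEquiv.symm_apply_apply, ContinuousLinearMap.one_def,
        ContinuousLinearMap.comp_id]
    simp only [map_add, map_sum, map_smul, hj]
    ext <;> simp [Prod.fst_sum, Prod.snd_sum]
  have hbox : ∀ v' ∈ Icc c' d', (Θ.symm v').1 ∈ Icc c d ∧ (Θ.symm v').2 ∈ 𝒩 := by
    intro v' hv'
    refine ⟨⟨fun i => ?_, fun i => ?_⟩, ⟨fun i j => ?_, fun i j => ?_⟩⟩
    · rw [hΘs1]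
      exact hv'.1 (Sum.inl i)
    · rw [hΘs1]
      exact hv'.2 (Sum.inl i)
    · show CN i j ≤ (Θ.symm v').2 (Pi.single j 1) i
      rw [hΘs2]
      exact hv'.1 (Sum.inr (i, j))
    · show (Θ.symm v').2 (Pi.single j 1) i ≤ DN i j
      rw [hΘs2]
      exact hv'.2 (Sum.inr (i, j))
  have hincla : ∀ t ∈ Icc 0 h, ∀ v' ∈ Icc c' d',
      (∑ j ∈ Finset.range K, t ^ j • Φa j w₀) + t ^ K • v' ∈ S' := by
    intro t ht v' hv'
    obtain ⟨hv, hNm⟩ := hbox v' hv'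
    show (Θ.symm ((∑ j ∈ Finset.range K, t ^ j • Φa j w₀) + t ^ K • v')).1 ∈ S ∧
      (Θ.symm ((∑ j ∈ Finset.range K, t ^ j • Φa j w₀) + t ^ K • v')).2 ∈ 𝒱
    rw [hdec]
    exact ⟨hincl t ht _ hv, hinclV t ht _ hNm⟩
  -- the high-order enclosure theorem for the augmented system, transported back
  obtain ⟨z, hz0, hzd, hzS⟩ := exists_solution_of_highOrderEnclosure (f := fa) (Φ := Φa)
    (Φ' := Φa') (Ω := Ω') (S := S') hK (y₀ := w₀) hS'Ω' hΦa0 hdera hreca hbda hlipa hcd' hKSa hh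
    hincla
  have hderF : ∀ t ∈ Icc 0 h, HasDerivWithinAt (fun s => Θ.symm (z s))
      (f (Θ.symm (z t)).1, (f' (Θ.symm (z t)).1).comp (Θ.symm (z t)).2) (Icc 0 h) t := by
    intro t ht
    have h1 := Θi.hasFDerivAt.comp_hasDerivWithinAt t (hzd t ht)
    rw [hΘi, hfa, ContinuousLinearEquiv.symm_apply_apply, hFa] at h1
    exact h1
  refine ⟨fun t => (Θ.symm (z t)).1, fun t => (Θ.symm (z t)).2, ?_, ?_, ?_, ?_, ?_⟩
  · show (Θ.symm (z 0)).1 = x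
    rw [hz0, hw₀, ContinuousLinearEquiv.symm_apply_apply]
  · show (Θ.symm (z 0)).2 = 1
    rw [hz0, hw₀, ContinuousLinearEquiv.symm_apply_apply]
  · intro t ht
    exact (ContinuousLinearMap.fst ℝ (ι → ℝ)
      ((ι → ℝ) →L[ℝ] (ι → ℝ))).hasFDerivAt.comp_hasDerivWithinAt t (hderF t ht)
  · intro t ht
    exact (ContinuousLinearMap.snd ℝ (ι → ℝ)
      ((ι → ℝ) →L[ℝ] (ι → ℝ))).hasFDerivAt.comp_hasDerivWithinAt t (hderF t ht)
  · intro t ht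
    obtain ⟨hmem, v', hv', hzt⟩ := hzS t ht
    obtain ⟨hv, hNm⟩ := hbox v' hv'
    have hpair : Θ.symm (z t) =
        ((∑ j ∈ Finset.range K, t ^ j • Φ j x) + t ^ K • (Θ.symm v').1,
          (∑ j ∈ Finset.range K, t ^ j • Φ' j x) + t ^ K • (Θ.symm v').2) := by
      rw [hzt, hdec]
    refine ⟨⟨hmem.1, (Θ.symm v').1, hv, ?_⟩, hmem.2, (Θ.symm v').2, hNm, ?_⟩
    · show (Θ.symm (z t)).1 = _
      rw [hpair]
    · show (Θ.symm (z t)).2 = _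
      rw [hpair]


/-- **Every solution of the variational system is enclosed (existence AND uniqueness in the
`C¹` a priori enclosure; Walawska–Wilczak 2016 §2.1, Zgliczyński 2002).** Under the hypotheses
of `exists_solution_of_variationalEnclosure`, if `f` is moreover Lipschitz on bounded sets, then
EVERY pair `(z, J)` solving `z' = f(z)`, `J' = f'(z) ∘ J` on `[0, h]` with `z 0 = x`, `J 0 = Id`
satisfies `z t ∈ S`, `z t ∈ ∑_{j<K} t^j Φ j x + t^K [c, d]`, `J t ∈ [CV, DV]` and
`J t ∈ ∑_{j<K} t^j Φ' j x + t^K [CN, DN]` (entrywise) for all `t ∈ [0, h]`.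
[cite: WalawskaWilczak2016, §2.1 (C¹ high-order enclosure) and §2.2 Lemma 2] -/
theorem solution_mem_of_variationalEnclosure {f : (ι → ℝ) → ι → ℝ}
    {f' : (ι → ℝ) → ((ι → ℝ) →L[ℝ] (ι → ℝ))}
    {Φ : ℕ → (ι → ℝ) → ι → ℝ} {Φ' : ℕ → (ι → ℝ) → ((ι → ℝ) →L[ℝ] (ι → ℝ))}
    {Φ'' : ℕ → (ι → ℝ) → ((ι → ℝ) →L[ℝ] (ι → ℝ) →L[ℝ] (ι → ℝ))} {Ω S : Set (ι → ℝ)}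
    {K : ℕ} (hK : 0 < K) {L L' : ℝ≥0} {B : ℝ} {c d x : ι → ℝ} {CV DV CN DN : ι → ι → ℝ} {h : ℝ}
    (hΩ : IsOpen Ω) (hSΩ : S ⊆ Ω)
    (hΦ0 : ∀ x, Φ 0 x = x) (hΦ'0 : ∀ x, Φ' 0 x = 1)
    (hder : ∀ j ≤ K, ∀ x ∈ Ω, HasFDerivAt (Φ j) (Φ' j x) x)
    (hder2 : ∀ j < K, ∀ x ∈ Ω, HasFDerivAt (Φ' j) (Φ'' j x) x)
    (hf' : ∀ x ∈ Ω, HasFDerivAt f (f' x) x)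
    (hrec : ∀ j < K, ∀ x ∈ Ω, Φ' j x (f x) = ((j : ℝ) + 1) • Φ (j + 1) x)
    (hbd : ∀ j ≤ K, ∀ x ∈ S, ‖Φ' j x‖ ≤ B) (hbd2 : ∀ j < K, ∀ x ∈ S, ‖Φ'' j x‖ ≤ B)
    (hlipK : LipschitzOnWith L (Φ K) S) (hlipK' : LipschitzOnWith L' (Φ' K) S)
    (hcd : c ≤ d) (hKS : MapsTo (Φ K) S (Icc c d)) (hCDN : CN ≤ DN)
    (hKN : ∀ z ∈ S, ∀ M : (ι → ℝ) →L[ℝ] (ι → ℝ), (fun i j => M (Pi.single j 1) i) ∈ Icc CV DV →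
      (fun i j => (Φ' K z).comp M (Pi.single j 1) i) ∈ Icc CN DN)
    (hh : 0 ≤ h)
    (hincl : ∀ t ∈ Icc 0 h, ∀ v ∈ Icc c d,
      (∑ j ∈ Finset.range K, t ^ j • Φ j x) + t ^ K • v ∈ S)
    (hinclV : ∀ t ∈ Icc 0 h, ∀ N : (ι → ℝ) →L[ℝ] (ι → ℝ),
      (fun i j => N (Pi.single j 1) i) ∈ Icc CN DN →
      (fun i j => ((∑ k ∈ Finset.range K, t ^ k • Φ' k x) + t ^ K • N) (Pi.single j 1) i) ∈
        Icc CV DV)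
    (hloc : ∀ ρ : ℝ, ∃ K' : ℝ≥0, LipschitzOnWith K' f (closedBall 0 ρ))
    {z : ℝ → ι → ℝ} {J : ℝ → (ι → ℝ) →L[ℝ] (ι → ℝ)} (hz0 : z 0 = x) (hJ0 : J 0 = 1)
    (hz : ∀ t ∈ Icc 0 h, HasDerivWithinAt z (f (z t)) (Icc 0 h) t)
    (hJ : ∀ t ∈ Icc 0 h, HasDerivWithinAt J ((f' (z t)).comp (J t)) (Icc 0 h) t)
    {t : ℝ} (ht : t ∈ Icc 0 h) :
    (z t ∈ S ∧ ∃ v ∈ Icc c d, z t = (∑ j ∈ Finset.range K, t ^ j • Φ j x) + t ^ K • v) ∧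
      (fun i j => J t (Pi.single j 1) i) ∈ Icc CV DV ∧
      ∃ N : (ι → ℝ) →L[ℝ] (ι → ℝ), (fun i j => N (Pi.single j 1) i) ∈ Icc CN DN ∧
        J t = (∑ j ∈ Finset.range K, t ^ j • Φ' j x) + t ^ K • N := by
  obtain ⟨y, V, hy0, hV0, hy, hV, henc⟩ := exists_solution_of_variationalEnclosure hK hΩ hSΩ hΦ0
    hΦ'0 hder hder2 hf' hrec hbd hbd2 hlipK hlipK' hcd hKS hCDN hKN hh hincl hinclV
  have hEq : EqOn y z (Icc 0 h) := eqOn_Icc_of_locLipschitz hloc hy hz (hy0.trans hz0.symm)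
  -- `f' = Φ' 1` on `Ω`, hence `‖f' (y s)‖ ≤ B`
  have hfΦ : ∀ p ∈ Ω, f p = Φ 1 p := fun p hp => by
    have h1 := hrec 0 hK p hp
    simpa [hΦ'0] using h1
  have hA : ∀ s ∈ Ico 0 h, ‖f' (y s)‖ ≤ B := fun s hs => by
    have hyS : y s ∈ S := (henc s (Ico_subset_Icc_self hs)).1.1
    have h1 : HasFDerivAt f (Φ' 1 (y s)) (y s) :=
      (hder 1 (Nat.succ_le_of_lt hK) _ (hSΩ hyS)).congr_of_eventuallyEq
        ((hΩ.eventually_mem (hSΩ hyS)).mono fun p hp => hfΦ p hp)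
    rw [(hf' _ (hSΩ hyS)).unique h1]
    exact hbd 1 (Nat.succ_le_of_lt hK) _ hyS
  have hJ' : ∀ s ∈ Icc 0 h, HasDerivWithinAt J ((f' (y s)).comp (J s)) (Icc 0 h) s :=
    fun s hs => by rw [hEq hs]; exact hJ s hs
  have hVJ : V t = J t := eqOn_Icc_of_linear hV hJ' hA (hV0.trans hJ0.symm) ht
  obtain ⟨hyenc, hVenc, N, hN, hVt⟩ := henc t ht
  rw [hEq ht] at hyenc
  rw [hVJ] at hVenc hVt
  exact ⟨hyenc, hVenc, N, hN, hVt⟩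

/-- **The step form of the `C¹` high-order enclosure test** (a box `W` of initial points, as a
`C¹`-Lohner integrator applies it per step: `W + ∑_{1≤j<K} [0,h]^j f^[j](W) + [0,h]^K f^[K](S) ⊆ S`
and `∑_{j<K} [0,h]^j Df^[j](W) + [0,h]^K (Df^[K](S) Ṽ) ⊆ Ṽ` imply the pointwise hypotheses below
for every `x ∈ W`). For every `x ∈ W` the variational system from `(x, Id)` has a solution on
`[0, h]`, and (for `f` Lipschitz on bounded sets) every solution pair satisfies `z t ∈ S`,
`J t ∈ Ṽ = [CV, DV]` and the tight enclosures on `[0, h]`.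
[cite: WalawskaWilczak2016, §2.1 (C¹ high-order enclosure) and §2.2 Lemma 2] -/
theorem variationalEnclosure_step {f : (ι → ℝ) → ι → ℝ}
    {f' : (ι → ℝ) → ((ι → ℝ) →L[ℝ] (ι → ℝ))}
    {Φ : ℕ → (ι → ℝ) → ι → ℝ} {Φ' : ℕ → (ι → ℝ) → ((ι → ℝ) →L[ℝ] (ι → ℝ))}
    {Φ'' : ℕ → (ι → ℝ) → ((ι → ℝ) →L[ℝ] (ι → ℝ) →L[ℝ] (ι → ℝ))} {Ω S W : Set (ι → ℝ)}
    {K : ℕ} (hK : 0 < K) {L L' : ℝ≥0} {B : ℝ} {c d : ι → ℝ} {CV DV CN DN : ι → ι → ℝ} {h : ℝ}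
    (hΩ : IsOpen Ω) (hSΩ : S ⊆ Ω)
    (hΦ0 : ∀ x, Φ 0 x = x) (hΦ'0 : ∀ x, Φ' 0 x = 1)
    (hder : ∀ j ≤ K, ∀ x ∈ Ω, HasFDerivAt (Φ j) (Φ' j x) x)
    (hder2 : ∀ j < K, ∀ x ∈ Ω, HasFDerivAt (Φ' j) (Φ'' j x) x)
    (hf' : ∀ x ∈ Ω, HasFDerivAt f (f' x) x)
    (hrec : ∀ j < K, ∀ x ∈ Ω, Φ' j x (f x) = ((j : ℝ) + 1) • Φ (j + 1) x)
    (hbd : ∀ j ≤ K, ∀ x ∈ S, ‖Φ' j x‖ ≤ B) (hbd2 : ∀ j < K, ∀ x ∈ S, ‖Φ'' j x‖ ≤ B)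
    (hlipK : LipschitzOnWith L (Φ K) S) (hlipK' : LipschitzOnWith L' (Φ' K) S)
    (hcd : c ≤ d) (hKS : MapsTo (Φ K) S (Icc c d)) (hCDN : CN ≤ DN)
    (hKN : ∀ z ∈ S, ∀ M : (ι → ℝ) →L[ℝ] (ι → ℝ), (fun i j => M (Pi.single j 1) i) ∈ Icc CV DV →
      (fun i j => (Φ' K z).comp M (Pi.single j 1) i) ∈ Icc CN DN)
    (hh : 0 ≤ h) (hloc : ∀ ρ : ℝ, ∃ K' : ℝ≥0, LipschitzOnWith K' f (closedBall 0 ρ))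
    (hincl : ∀ x ∈ W, ∀ t ∈ Icc 0 h, ∀ v ∈ Icc c d,
      (∑ j ∈ Finset.range K, t ^ j • Φ j x) + t ^ K • v ∈ S)
    (hinclV : ∀ x ∈ W, ∀ t ∈ Icc 0 h, ∀ N : (ι → ℝ) →L[ℝ] (ι → ℝ),
      (fun i j => N (Pi.single j 1) i) ∈ Icc CN DN →
      (fun i j => ((∑ k ∈ Finset.range K, t ^ k • Φ' k x) + t ^ K • N) (Pi.single j 1) i) ∈
        Icc CV DV)
    {x : ι → ℝ} (hx : x ∈ W) :
    (∃ y : ℝ → ι → ℝ, ∃ V : ℝ → (ι → ℝ) →L[ℝ] (ι → ℝ), y 0 = x ∧ V 0 = 1 ∧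
      (∀ t ∈ Icc 0 h, HasDerivWithinAt y (f (y t)) (Icc 0 h) t) ∧
      ∀ t ∈ Icc 0 h, HasDerivWithinAt V ((f' (y t)).comp (V t)) (Icc 0 h) t) ∧
    ∀ (z : ℝ → ι → ℝ) (J : ℝ → (ι → ℝ) →L[ℝ] (ι → ℝ)), z 0 = x → J 0 = 1 →
      (∀ t ∈ Icc 0 h, HasDerivWithinAt z (f (z t)) (Icc 0 h) t) →
      (∀ t ∈ Icc 0 h, HasDerivWithinAt J ((f' (z t)).comp (J t)) (Icc 0 h) t) →
      ∀ t ∈ Icc 0 h,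
        (z t ∈ S ∧ ∃ v ∈ Icc c d, z t = (∑ j ∈ Finset.range K, t ^ j • Φ j x) + t ^ K • v) ∧
        (fun i j => J t (Pi.single j 1) i) ∈ Icc CV DV ∧
        ∃ N : (ι → ℝ) →L[ℝ] (ι → ℝ), (fun i j => N (Pi.single j 1) i) ∈ Icc CN DN ∧
          J t = (∑ j ∈ Finset.range K, t ^ j • Φ' j x) + t ^ K • N := by
  refine ⟨?_, fun z J hz0 hJ0 hz hJ t ht => solution_mem_of_variationalEnclosure hK hΩ hSΩ hΦ0
    hΦ'0 hder hder2 hf' hrec hbd hbd2 hlipK hlipK' hcd hKS hCDN hKN hh (hincl x hx) (hinclV x hx)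
    hloc hz0 hJ0 hz hJ ht⟩
  obtain ⟨y, V, hy0, hV0, hy, hV, -⟩ := exists_solution_of_variationalEnclosure hK hΩ hSΩ hΦ0
    hΦ'0 hder hder2 hf' hrec hbd hbd2 hlipK hlipK' hcd hKS hCDN hKN hh (hincl x hx) (hinclV x hx)
  exact ⟨y, V, hy0, hV0, hy, hV⟩

/-- **The variational enclosure bounds the derivative of the flow (Zgliczyński 2002;
Walawska–Wilczak 2016, §2: `V(t, x) = ∂φ/∂x (t, x)`).** Under the hypotheses of
`variationalEnclosure_step` (state box `S` convex with unique tangents, `f` of class `C¹` on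
`S`), for ANY family `u` of solutions of `y' = f(y)` on `[0, h]` from the points of `W` staying
in `S`, every `x ∈ W` and `τ ∈ [0, h]`: the flow map `x' ↦ u x' τ` has a derivative `J` at `x`
within `W`, and `J ∈ [CV, DV]`, `J = ∑_{j<K} τ^j • Φ' j x + τ^K • N` with `N ∈ [CN, DN]`
(entrywise) — i.e. the interval matrix `∑_{j<K} [0,h]^j Df^[j](W) + [0,h]^K Df^[K](S) Ṽ`
contains `∂φ(τ, x)/∂x` for all `x ∈ W` (the variational equation differentiates the flow:
`IsSolutionFamily.hasFDerivWithinAt` of `FlowWithin.lean`).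
[cite: WalawskaWilczak2016, §1.1 (ψ = D_xφ·V) and §2.2 Lemma 2] -/
theorem hasFDerivWithinAt_flow_of_variationalEnclosure {f : (ι → ℝ) → ι → ℝ}
    {f' : (ι → ℝ) → ((ι → ℝ) →L[ℝ] (ι → ℝ))}
    {Φ : ℕ → (ι → ℝ) → ι → ℝ} {Φ' : ℕ → (ι → ℝ) → ((ι → ℝ) →L[ℝ] (ι → ℝ))}
    {Φ'' : ℕ → (ι → ℝ) → ((ι → ℝ) →L[ℝ] (ι → ℝ) →L[ℝ] (ι → ℝ))} {Ω S W : Set (ι → ℝ)}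
    {K : ℕ} (hK : 0 < K) {L L' : ℝ≥0} {B : ℝ} {c d : ι → ℝ} {CV DV CN DN : ι → ι → ℝ} {h : ℝ}
    (hΩ : IsOpen Ω) (hSΩ : S ⊆ Ω)
    (hΦ0 : ∀ x, Φ 0 x = x) (hΦ'0 : ∀ x, Φ' 0 x = 1)
    (hder : ∀ j ≤ K, ∀ x ∈ Ω, HasFDerivAt (Φ j) (Φ' j x) x)
    (hder2 : ∀ j < K, ∀ x ∈ Ω, HasFDerivAt (Φ' j) (Φ'' j x) x)
    (hf' : ∀ x ∈ Ω, HasFDerivAt f (f' x) x)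
    (hrec : ∀ j < K, ∀ x ∈ Ω, Φ' j x (f x) = ((j : ℝ) + 1) • Φ (j + 1) x)
    (hbd : ∀ j ≤ K, ∀ x ∈ S, ‖Φ' j x‖ ≤ B) (hbd2 : ∀ j < K, ∀ x ∈ S, ‖Φ'' j x‖ ≤ B)
    (hlipK : LipschitzOnWith L (Φ K) S) (hlipK' : LipschitzOnWith L' (Φ' K) S)
    (hcd : c ≤ d) (hKS : MapsTo (Φ K) S (Icc c d)) (hCDN : CN ≤ DN)
    (hKN : ∀ z ∈ S, ∀ M : (ι → ℝ) →L[ℝ] (ι → ℝ), (fun i j => M (Pi.single j 1) i) ∈ Icc CV DV →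
      (fun i j => (Φ' K z).comp M (Pi.single j 1) i) ∈ Icc CN DN)
    (hh : 0 ≤ h) (hloc : ∀ ρ : ℝ, ∃ K' : ℝ≥0, LipschitzOnWith K' f (closedBall 0 ρ))
    (hincl : ∀ x ∈ W, ∀ t ∈ Icc 0 h, ∀ v ∈ Icc c d,
      (∑ j ∈ Finset.range K, t ^ j • Φ j x) + t ^ K • v ∈ S)
    (hinclV : ∀ x ∈ W, ∀ t ∈ Icc 0 h, ∀ N : (ι → ℝ) →L[ℝ] (ι → ℝ),
      (fun i j => N (Pi.single j 1) i) ∈ Icc CN DN →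
      (fun i j => ((∑ k ∈ Finset.range K, t ^ k • Φ' k x) + t ^ K • N) (Pi.single j 1) i) ∈
        Icc CV DV)
    (hSc : Convex ℝ S) (hSu : UniqueDiffOn ℝ S) (hfC : ContDiffOn ℝ 1 f S)
    {u : (ι → ℝ) → ℝ → ι → ℝ} (hu : IsSolutionFamily f S W h u) {x : ι → ℝ} (hx : x ∈ W)
    {τ : ℝ} (hτ : τ ∈ Icc 0 h) :
    ∃ J : (ι → ℝ) →L[ℝ] (ι → ℝ), HasFDerivWithinAt (fun x' => u x' τ) J W x ∧
      (fun i j => J (Pi.single j 1) i) ∈ Icc CV DV ∧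
      ∃ N : (ι → ℝ) →L[ℝ] (ι → ℝ), (fun i j => N (Pi.single j 1) i) ∈ Icc CN DN ∧
        J = (∑ j ∈ Finset.range K, τ ^ j • Φ' j x) + τ ^ K • N := by
  obtain ⟨y, V, hy0, hV0, hy, hV, henc⟩ := exists_solution_of_variationalEnclosure hK hΩ hSΩ hΦ0
    hΦ'0 hder hder2 hf' hrec hbd hbd2 hlipK hlipK' hcd hKS hCDN hKN hh (hincl x hx) (hinclV x hx)
  have hEq : EqOn y (u x) (Icc 0 h) :=
    eqOn_Icc_of_locLipschitz hloc hy (hu.hasDerivWithinAt x hx) (hy0.trans (hu.init x hx).symm)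
  have hVJ : ∀ t ∈ Icc 0 h,
      HasDerivWithinAt V ((fderivWithin ℝ f S (u x t)).comp (V t)) (Icc 0 h) t := by
    intro t ht
    have huS : u x t ∈ S := hu.mem x hx t ht
    have hfd : fderivWithin ℝ f S (u x t) = f' (u x t) :=
      (hf' _ (hSΩ huS)).hasFDerivWithinAt.fderivWithin (hSu _ huS)
    rw [hfd, ← hEq ht]
    exact hV t ht
  obtain ⟨-, hVenc, N, hN, hVt⟩ := henc τ hτ
  exact ⟨V τ, hu.hasFDerivWithinAt hh hSc hSu hfC hx hV0 hVJ hτ, hVenc, N, hN, hVt⟩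

end Variational

end Literature.Analysis.ODE

end
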